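import Mathlib
import Literature.RepresentationTheory.FiniteGroups.CharacterDegrees
import Literature.RepresentationTheory.FiniteGroups.IrreducibleCharacters
import Literature.RepresentationTheory.FiniteGroups.InducedClassFunction
import Literature.RepresentationTheory.FiniteGroups.BrauerInduction
import Literature.RepresentationTheory.FiniteGroups.BrauerTheorem
import Literature.RepresentationTheory.FiniteGroups.MonomialRepresentation
import Summits.MatrixMultiplication.MatrixMultiplication.Theorems.LieRankDesigns.Negative.Basics
import Summits.MatrixMultiplication.MatrixMultiplication.Theorems.SubgroupIdentityDesigns.Negative.LineStabilizer

/-!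
# The permutation character of `GL_n(F)` on lines: `Ind_P^G 1 − 1` is irreducible

Character-theoretic half of the UNCONDITIONAL budget lemma for the crux `SubgroupIdentityDesigns`
(stmt-MatrixMultiplication-14079; BLOCK-SLICES Lemma 2.1 at `k = 1`).  VALUE = theorem, NOT summit
progress.  With `P = lineStab i₀ ≤ G = GL_n(F)` (`F` a finite field, `n ≥ 2`) and
`θ = Ind_P^G 1 = indClassFun P 1` (a character: `isCharacter_indClassFun_monoidHom`, the monomial
representation on `ℂ[G/P]`):
* `theta_apply` — `θ(y) = #{q ∈ G/P : y q = q}` (Serre §7.2, `indClassFun_eq_sum_quotient`);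
* `classInner_theta_triv` — `⟨θ, 1⟩ = 1`, `classInner_theta_theta` — `⟨θ, θ⟩ = 2` (Frobenius
  reciprocity `classInner_indClassFun_left` + the two-orbit count `LineStabilizer.sum_card_fixed`);
* `isIrrChar_theta_sub_triv` — `θ − 1_G` is an IRREDUCIBLE character (decompose `θ = ∑ nᵢ χᵢ`:
  `n_1 = ⟨θ,1⟩ = 1` and `∑ nᵢ² = 2` force `θ = 1 + χ`), and `theta_sub_triv_one` — its degree is
  `[G : P] − 1`.
This is the standard fact "the permutation character of a doubly transitive action minus the trivial
character is irreducible" (Serre, *Linear Representations* §2.3 Ex. 2.6; Isaacs, *Character Theory*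
Cor. 5.17), here for `GL_n` on `ℙ^{n-1}`, where `θ − 1` is the unipotent (Steinberg-type) character
`χ^{(n-1,1)}` of degree `q + q² + ⋯ + q^{n-1}`.
-/

set_option linter.dupNamespace false

noncomputable section

open scoped BigOperators Matrix Classical
open Literature.RepresentationTheory.FiniteGroups
open Summit.MatrixMultiplication.MatrixMultiplication.Theorems.LieRankDesigns.Negative
  (character_trivial_apply)

namespace Summit.MatrixMultiplication.MatrixMultiplication.Theorems.SubgroupIdentityDesigns.Negative
namespace LineStabilizerCharacter

open LineStabilizer

variable {F : Type} [Field F] [Fintype F] [DecidableEq F] {n : ℕ} (i₀ : Fin n)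

local notation "G₀" => GL (Fin n) F
local notation "P₀" => lineStab (F := F) i₀
local notation "Q₀" => GL (Fin n) F ⧸ lineStab (F := F) i₀
/-- `θ = Ind_P^G 1`, the permutation character of `GL_n(F)` on the lines of `F^n`. -/
local notation "θ" => indClassFun (G := GL (Fin n) F) (lineStab (F := F) i₀) (fun _ => (1 : ℂ))
/-- The trivial character. -/
local notation "𝟙" => Representation.character (Representation.trivial ℂ (GL (Fin n) F) ℂ)

/-- `θ` is a character of `G` (the character of the monomial representation `Ind_P^G 1`). -/
theorem isCharacter_theta : IsCharacter G₀ θ := by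
  have h : (fun h : P₀ => (((1 : P₀ →* ℂˣ) h : ℂˣ) : ℂ)) = fun _ => 1 := funext fun h => by simp
  have := isCharacter_indClassFun_monoidHom (lineStab (F := F) i₀) 1
  rw [h] at this
  exact this

/-- `θ(y)` is the number of cosets (lines) fixed by `y`. -/
theorem theta_apply (y : G₀) :
    θ y = ((Finset.univ.filter fun q : Q₀ => y • q = q).card : ℂ) := by
  rw [indClassFun_eq_sum_quotient _ (fun _ _ => rfl), Finset.natCast_card_filter]
  refine Finset.sum_congr rfl fun q _ => ?_
  by_cases hq : y • q = q
  · rw [if_pos hq]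
    exact extend_subtypeVal_apply _ _ ⟨_, (smul_eq_self_iff_mem _ y q).mp hq⟩
  · rw [if_neg hq]
    exact extend_subtypeVal_of_not_mem _ _ fun hm => hq ((smul_eq_self_iff_mem _ y q).mpr hm)

/-- `θ(1) = [G : P]`. -/
theorem theta_one : θ 1 = (Fintype.card Q₀ : ℂ) := by
  rw [theta_apply, Finset.filter_true_of_mem fun q _ => one_smul _ q, Finset.card_univ]

/-- `⟨θ, 1_G⟩ = 1` (Frobenius reciprocity: `= ⟨1_P, 1_P⟩_P`). -/
theorem classInner_theta_triv : classInner θ 𝟙 = 1 := by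
  have h1 : (𝟙 : G₀ → ℂ) = fun _ => 1 := funext character_trivial_apply
  rw [h1, classInner_indClassFun_left _ _ (fun _ _ => rfl), classInner_apply]
  simp only [Finset.sum_const, Finset.card_univ, nsmul_eq_mul, mul_one]
  exact inv_mul_cancel₀ (Nat.cast_ne_zero.mpr Fintype.card_ne_zero)

/-- `⟨θ, θ⟩ = 2` for `n ≥ 2` (Frobenius reciprocity + Burnside: `P` has two orbits on `G/P`). -/
theorem classInner_theta_theta (hn : 1 < n) : classInner θ θ = 2 := by
  rw [classInner_indClassFun_left _ _ (isClassFun_indClassFun _ _), classInner_apply]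
  have hterm : ∀ s : P₀, (fun _ : P₀ => (1 : ℂ)) s * (fun x : P₀ => θ x) s⁻¹ =
      ((Finset.univ.filter fun q : Q₀ => s • q = q).card : ℂ) := by
    intro s
    rw [one_mul]
    show θ ((s⁻¹ : P₀) : G₀) = _
    rw [theta_apply]
    congr 2
    ext q
    simp only [Finset.mem_filter, Finset.mem_univ, true_and, Subgroup.coe_inv]
    rw [inv_smul_eq_iff, eq_comm]
    rfl
  rw [Finset.sum_congr rfl fun s _ => hterm s, ← Nat.cast_sum, sum_card_fixed i₀ hn]
  have hc : (Fintype.card P₀ : ℂ) ≠ 0 := Nat.cast_ne_zero.mpr Fintype.card_ne_zero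
  rw [Nat.cast_mul, Nat.cast_two, mul_comm (2 : ℂ), ← mul_assoc, inv_mul_cancel₀ hc, one_mul]

/-- Expansion of `⟨φ − ψ, φ − ψ⟩`. -/
theorem classInner_sub_sub (φ ψ : G₀ → ℂ) :
    classInner (φ - ψ) (φ - ψ) = classInner φ φ - classInner φ ψ - classInner ψ φ + classInner ψ ψ := by
  simp only [classInner_apply, Pi.sub_apply, sub_mul, mul_sub, Finset.sum_sub_distrib]
  ring

/-- `⟨θ − 1, θ − 1⟩ = 1` for `n ≥ 2`. -/
theorem classInner_theta_sub_triv (hn : 1 < n) : classInner (θ - 𝟙) (θ - 𝟙) = 1 := by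
  have htriv : IsIrrChar G₀ 𝟙 := character_trivial_mem_irrChars
  rw [classInner_sub_sub, classInner_theta_theta i₀ hn, classInner_comm 𝟙 θ,
    classInner_theta_triv, htriv.classInner_eq htriv, if_pos rfl]
  norm_num

/-- A multiset of irreducible characters whose sum `σ` has `⟨σ, σ⟩ = 1` is a singleton. -/
theorem multiset_eq_singleton {m : Multiset (G₀ → ℂ)} (hm : ∀ χ ∈ m, IsIrrChar G₀ χ)
    (hone : classInner m.sum m.sum = 1) : ∃ χ, m = {χ} := by
  have hexp : classInner m.sum m.sum = ((∑ χ ∈ m.toFinset, m.count χ * m.count χ : ℕ) : ℂ) := by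
    rw [classInner_multiset_sum_left, Finset.sum_multiset_map_count]
    push_cast
    refine Finset.sum_congr rfl fun χ hχ => ?_
    rw [classInner_comm, classInner_multiset_sum_irrChars hm (hm χ (Multiset.mem_toFinset.mp hχ)),
      nsmul_eq_mul]
  rw [hexp] at hone
  have hone' : ∑ χ ∈ m.toFinset, m.count χ * m.count χ = 1 := by exact_mod_cast hone
  have hle : Multiset.card m ≤ 1 := by
    rw [← Multiset.toFinset_sum_count_eq, ← hone']
    exact Finset.sum_le_sum fun χ _ => Nat.le_mul_self _
  have hne : Multiset.card m ≠ 0 := by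
    intro h0
    rw [Multiset.card_eq_zero.mp h0] at hone'
    simp at hone'
  exact Multiset.card_eq_one.mp (by omega)

/-- **`θ − 1_G` is an irreducible character of `GL_n(F)`** (`n ≥ 2`). -/
theorem isIrrChar_theta_sub_triv (hn : 1 < n) : IsIrrChar G₀ (θ - 𝟙) := by
  obtain ⟨m, hm, hsum⟩ := (isCharacter_theta (F := F) i₀).exists_multiset_irrChars
  have htriv : IsIrrChar G₀ 𝟙 := character_trivial_mem_irrChars
  have hcount : m.count 𝟙 = 1 := by
    have h := classInner_multiset_sum_irrChars hm htriv
    rw [← hsum, classInner_theta_triv] at h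
    exact_mod_cast h.symm
  obtain ⟨m', rfl⟩ : ∃ m', m = 𝟙 ::ₘ m' :=
    Multiset.exists_cons_of_mem (Multiset.count_pos.mp (by omega))
  have hm' : ∀ χ ∈ m', IsIrrChar G₀ χ := fun χ hχ => hm χ (Multiset.mem_cons_of_mem hχ)
  have hsum' : θ - 𝟙 = m'.sum := by
    rw [hsum, Multiset.sum_cons, add_sub_cancel_left]
  rw [hsum']
  have hone : classInner m'.sum m'.sum = 1 := by
    rw [← hsum']
    exact classInner_theta_sub_triv i₀ hn
  obtain ⟨χ, rfl⟩ := multiset_eq_singleton hm' hone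
  rw [Multiset.sum_singleton]
  exact hm' χ (Multiset.mem_singleton_self χ)

/-- Its degree: `(θ − 1)(1) = [G : P] − 1`. -/
theorem theta_sub_triv_one : (θ - 𝟙) 1 = (Fintype.card Q₀ : ℂ) - 1 := by
  rw [Pi.sub_apply, theta_one, character_trivial_apply]

end LineStabilizerCharacter
end Summit.MatrixMultiplication.MatrixMultiplication.Theorems.SubgroupIdentityDesigns.Negative
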